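import Summits.CriticalPhenomena.PercolationContinuityZ3.Theorems.SahiMasterFamilyFCombPeelable
import Summits.CriticalPhenomena.PercolationContinuityZ3.Theorems.SahiMasterFamilyFCombFormulaDefs
import Mathlib.Tactic.Linarith
import HarnessLib

/-!
# The comb form of the `F`-inequality is nonnegative for every READ-ONCE third event

Support file (cell `prim-bnk`, seat bnk-2 gen 20; `--supports stmt-CriticalPhenomena-4575`; memo
`run/shared/lean/prim/prim-l12/FROM-prim-bnk-2-g20-CP-CERTIFICATES.md`, Theorem 3).  No `sorry`, standard axioms.

For increasing events `A, B, G` on `Fin n → Bool` the top tensor-Bernstein coefficient of the conjectured master-family inequality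
`F(A,B;G) = (1+μG)μ(ABG) − μG·μ(AB) − μ(AG)μ(BG) ≥ 0` (`prim-master-conj`, POINTWISE §21) is
`K(A,B,G) = #{x∈ABG} − #{x∈AG : x̄∈BG} − #{x∈G : x̄∈AB∖G}` (`x̄` the antipode).  THIS FILE PROVES

**THEOREM (`comb_sum_nonneg_of_readOnce`).  `K(A,B,G) ≥ 0` for all monotone `A, B` whenever `G = eval φ` for a READ-ONCE monotone
formula `φ`** (an AND/OR formula in which every variable occurs at most once — any number of variables, any depth).

Proof.  `peelable_of_readOnce`: a read-once event is `Peelable` (companion file), by induction on the dimension: a variable not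
occurring in the (normalised) formula has empty pivotal set and is peeled first; otherwise the formula is constant-free with all
variables occurring, so some gate has two leaf children `var e`, `var f` (`exists_pair_of_noConst`), and **Lemma B**
(`pivotal_forces_sibling`): `e` is pivotal at `x` only if `x f` equals the value dictated by the gate — which fails at the facet
antipode — so `e` carries no doubly-pivotal antipodal pair; the sections `x_e := t` are read-once formulas one dimension down
(`substMap`).  Then `comb_sum_nonneg_of_peelable`.  Since restrictions of read-once events to faces are read-once, every
tensor-Bernstein coefficient of `F(A,B;G)` is `≥ 0`, hence **`F(A,B;G) ≥ 0` for all increasing `A, B` and every product measure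
whenever `G` is read-once** (memo Theorem 3; the Bernstein-expansion bookkeeping `K ≥ 0 on faces ⟹ F ≥ 0` is the part NOT yet
formalised).  This class contains the principal filters, ORs of coordinates, caterpillars, every `G` with `≤ 2` minimal elements
(`x_a ∨ x_b = x_{a∩b}(x_{a∖b} ∨ x_{b∖a})`) and all deeper formula trees, in every dimension.  HONEST FRAMING: comb inequality
for read-once third events; `F ≥ 0` for general `G` remains OPEN. [this work]
-/

namespace Summit.CriticalPhenomena.PercolationContinuityZ3.Theorems

namespace SahiFComb

open Finset

namespace MForm

variable {n : ℕ}

/-! ### 2. Lemma B: a leaf with a leaf sibling is never doubly pivotal on an antipodal pair -/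

/-- `HasPair e f φ`: the formula `φ` contains a gate whose two children are the leaves `var e` and `var f`;
the Boolean records the gate type (`true` = AND). -/
def HasPair (e f : Fin n) : MForm n → Prop
  | var _ => False
  | tt => False
  | ff => False
  | and g h => (g = var e ∧ h = var f) ∨ (g = var f ∧ h = var e) ∨ HasPair e f g ∨ HasPair e f h
  | or g h => (g = var e ∧ h = var f) ∨ (g = var f ∧ h = var e) ∨ HasPair e f g ∨ HasPair e f h

/-- A constant-free formula with at least two variables contains a gate with two leaf children. -/
theorem exists_pair_of_noConst (φ : MForm n) (hφ : NoConst φ) (h2 : ∀ i, φ ≠ var i) :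
    ∃ e f, HasPair e f φ := by
  induction φ with
  | var i => exact absurd rfl (h2 i)
  | tt => exact hφ.elim
  | ff => exact hφ.elim
  | and g h ihg ihh =>
      rcases hφ with ⟨hg, hh⟩
      by_cases hgv : ∃ i, g = var i
      · by_cases hhv : ∃ j, h = var j
        · obtain ⟨i, rfl⟩ := hgv; obtain ⟨j, rfl⟩ := hhv
          exact ⟨i, j, Or.inl ⟨rfl, rfl⟩⟩
        · push Not at hhv
          obtain ⟨e, f, hp⟩ := ihh hh hhv
          exact ⟨e, f, Or.inr (Or.inr (Or.inr hp))⟩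
      · push Not at hgv
        obtain ⟨e, f, hp⟩ := ihg hg hgv
        exact ⟨e, f, Or.inr (Or.inr (Or.inl hp))⟩
  | or g h ihg ihh =>
      rcases hφ with ⟨hg, hh⟩
      by_cases hgv : ∃ i, g = var i
      · by_cases hhv : ∃ j, h = var j
        · obtain ⟨i, rfl⟩ := hgv; obtain ⟨j, rfl⟩ := hhv
          exact ⟨i, j, Or.inl ⟨rfl, rfl⟩⟩
        · push Not at hhv
          obtain ⟨e, f, hp⟩ := ihh hh hhv
          exact ⟨e, f, Or.inr (Or.inr (Or.inr hp))⟩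
      · push Not at hgv
        obtain ⟨e, f, hp⟩ := ihg hg hgv
        exact ⟨e, f, Or.inr (Or.inr (Or.inl hp))⟩

/-- Both leaves of a leaf pair occur in the formula. -/
theorem mem_vars_of_hasPair {e f : Fin n} (φ : MForm n) (h : HasPair e f φ) : e ∈ vars φ ∧ f ∈ vars φ := by
  induction φ with
  | var i => exact h.elim
  | tt => exact h.elim
  | ff => exact h.elim
  | and g k ihg ihk =>
      simp only [vars, Finset.mem_union]
      rcases h with ⟨rfl, rfl⟩ | ⟨rfl, rfl⟩ | h | h
      · simp [vars]
      · simp [vars]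
      · exact ⟨Or.inl (ihg h).1, Or.inl (ihg h).2⟩
      · exact ⟨Or.inr (ihk h).1, Or.inr (ihk h).2⟩
  | or g k ihg ihk =>
      simp only [vars, Finset.mem_union]
      rcases h with ⟨rfl, rfl⟩ | ⟨rfl, rfl⟩ | h | h
      · simp [vars]
      · simp [vars]
      · exact ⟨Or.inl (ihg h).1, Or.inl (ihg h).2⟩
      · exact ⟨Or.inr (ihk h).1, Or.inr (ihk h).2⟩

/-- In a read-once formula the two leaves of a leaf pair are distinct variables. -/
theorem ne_of_hasPair {e f : Fin n} (φ : MForm n) (hro : ReadOnce φ) (hp : HasPair e f φ) : e ≠ f := by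
  induction φ with
  | var i => exact hp.elim
  | tt => exact hp.elim
  | ff => exact hp.elim
  | and g k ihg ihk =>
      rcases hp with ⟨rfl, rfl⟩ | ⟨rfl, rfl⟩ | h | h
      · have := hro.1; simp [vars] at this; exact this
      · have := hro.1; simp [vars] at this; exact Ne.symm this
      · exact ihg hro.2.1 h
      · exact ihk hro.2.2 h
  | or g k ihg ihk =>
      rcases hp with ⟨rfl, rfl⟩ | ⟨rfl, rfl⟩ | h | h
      · have := hro.1; simp [vars] at this; exact this
      · have := hro.1; simp [vars] at this; exact Ne.symm this
      · exact ihg hro.2.1 h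
      · exact ihk hro.2.2 h

/-- **Lemma B.**  In a read-once formula containing a gate with leaf children `var e`, `var f`, the variable `e` is pivotal at `x`
only if `x f` has the value dictated by the gate (`true` under an AND, `false` under an OR). -/
theorem pivotal_forces_sibling {e f : Fin n} (φ : MForm n) (hro : ReadOnce φ) (hp : HasPair e f φ) :
    ∃ c : Bool, ∀ x : Fin n → Bool,
      eval φ (Function.update x e true) = true → eval φ (Function.update x e false) = false → x f = c := by
  induction φ with
  | var i => exact hp.elim
  | tt => exact hp.elim
  | ff => exact hp.elim
  | and g k ihg ihk =>
      rcases hp with ⟨rfl, rfl⟩ | ⟨rfl, rfl⟩ | h | h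
      · have hef : e ≠ f := by have := hro.1; simp [vars] at this; exact this
        refine ⟨true, fun x h1 _ => ?_⟩
        simpa [eval, Function.update, hef.symm] using h1
      · have hef : e ≠ f := by have := hro.1; simp [vars] at this; exact Ne.symm this
        refine ⟨true, fun x h1 _ => ?_⟩
        simpa [eval, Function.update, hef.symm] using h1
      · obtain ⟨c, hc⟩ := ihg hro.2.1 h
        have hek : e ∉ vars k := Finset.disjoint_left.mp hro.1 (mem_vars_of_hasPair g h).1
        refine ⟨c, fun x h1 h0 => hc x ?_ ?_⟩
        · simp only [eval, eval_eq_of_not_mem_vars k hek, Bool.and_eq_true] at h1; exact h1.1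
        · simp only [eval, eval_eq_of_not_mem_vars k hek, Bool.and_eq_true] at h1
          simp only [eval, eval_eq_of_not_mem_vars k hek, h1.2, Bool.and_true] at h0; exact h0
      · obtain ⟨c, hc⟩ := ihk hro.2.2 h
        have heg : e ∉ vars g := Finset.disjoint_right.mp hro.1 (mem_vars_of_hasPair k h).1
        refine ⟨c, fun x h1 h0 => hc x ?_ ?_⟩
        · simp only [eval, eval_eq_of_not_mem_vars g heg, Bool.and_eq_true] at h1; exact h1.2
        · simp only [eval, eval_eq_of_not_mem_vars g heg, Bool.and_eq_true] at h1
          simp only [eval, eval_eq_of_not_mem_vars g heg, h1.1, Bool.true_and] at h0; exact h0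
  | or g k ihg ihk =>
      rcases hp with ⟨rfl, rfl⟩ | ⟨rfl, rfl⟩ | h | h
      · have hef : e ≠ f := by have := hro.1; simp [vars] at this; exact this
        refine ⟨false, fun x _ h0 => ?_⟩
        simpa [eval, Function.update, hef.symm] using h0
      · have hef : e ≠ f := by have := hro.1; simp [vars] at this; exact Ne.symm this
        refine ⟨false, fun x _ h0 => ?_⟩
        simpa [eval, Function.update, hef.symm] using h0
      · obtain ⟨c, hc⟩ := ihg hro.2.1 h
        have hek : e ∉ vars k := Finset.disjoint_left.mp hro.1 (mem_vars_of_hasPair g h).1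
        refine ⟨c, fun x h1 h0 => hc x ?_ ?_⟩
        · simp only [eval, eval_eq_of_not_mem_vars k hek, Bool.or_eq_false_iff] at h0
          simp only [eval, eval_eq_of_not_mem_vars k hek, h0.2, Bool.or_false] at h1; exact h1
        · simp only [eval, eval_eq_of_not_mem_vars k hek, Bool.or_eq_false_iff] at h0; exact h0.1
      · obtain ⟨c, hc⟩ := ihk hro.2.2 h
        have heg : e ∉ vars g := Finset.disjoint_right.mp hro.1 (mem_vars_of_hasPair k h).1
        refine ⟨c, fun x h1 h0 => hc x ?_ ?_⟩
        · simp only [eval, eval_eq_of_not_mem_vars g heg, Bool.or_eq_false_iff] at h0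
          simp only [eval, eval_eq_of_not_mem_vars g heg, h0.1, Bool.false_or] at h1; exact h1
        · simp only [eval, eval_eq_of_not_mem_vars g heg, Bool.or_eq_false_iff] at h0; exact h0.2

end MForm


/-! ### 3. Inserting a coordinate: the re-indexing map and `Function.update` -/

variable {n : ℕ}

/-- Updating the inserted coordinate. [folklore] -/
theorem update_insertNth (e : Fin (n + 1)) (s t : Bool) (y : Fin n → Bool) :
    Function.update (Fin.insertNth (α := fun _ => Bool) e s y) e t = Fin.insertNth (α := fun _ => Bool) e t y := by
  funext i
  refine Fin.succAboveCases e ?_ (fun j => ?_) i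
  · simp [Fin.insertNth_apply_same]
  · simp [Fin.insertNth_apply_succAbove, Function.update, Fin.succAbove_ne]

/-- `insertNth` through a left inverse of `succAbove`. [folklore] -/
theorem insertNth_eq_ite (e : Fin (n + 1)) (ψ : Fin (n + 1) → Fin n) (hψ : ∀ j, ψ (e.succAbove j) = j)
    (t : Bool) (y : Fin n → Bool) :
    Fin.insertNth (α := fun _ => Bool) e t y = fun j => if j = e then t else y (ψ j) := by
  funext i
  refine Fin.succAboveCases e ?_ (fun j => ?_) i
  · simp [Fin.insertNth_apply_same]
  · simp [Fin.insertNth_apply_succAbove, Fin.succAbove_ne, hψ]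

/-! ### 4. Read-once third events are peelable -/

/-- Main recursion: a normal read-once formula defines a peelable event. -/
theorem peelable_eval : ∀ (n : ℕ) (φ : MForm n), φ.ReadOnce → φ.Normal → Peelable n φ.eval
  | 0, φ, _, _ => Peelable.zero _
  | 1, φ, _, _ => Peelable.one _ (mono_along 0 (MForm.eval_mono φ))
  | (n + 2), φ, hro, hno => by
      -- the re-indexing map (a left inverse of `succAbove`)
      have hne : Nonempty (Fin (n + 1)) := ⟨0⟩
      by_cases hfree : ∃ e : Fin (n + 2), e ∉ φ.vars
      · -- (a) peel a variable the formula does not mention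
        obtain ⟨e, he⟩ := hfree
        let ψ : Fin (n + 2) → Fin (n + 1) := Function.invFun e.succAbove
        have hψ : ∀ j, ψ (e.succAbove j) = j := Function.leftInverse_invFun Fin.succAbove_right_injective
        have hsec : ∀ t : Bool, (fun y => φ.eval (Fin.insertNth e t y)) = (MForm.substMap e t ψ φ).eval := by
          intro t; funext y
          rw [MForm.eval_substMap, insertNth_eq_ite e ψ hψ]
        have hinj : ∀ i j, i ≠ e → j ≠ e → ψ i = ψ j → i = j := by
          intro i j hi hj hij
          obtain ⟨i', rfl⟩ := Fin.exists_succAbove_eq hi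
          obtain ⟨j', rfl⟩ := Fin.exists_succAbove_eq hj
          rw [hψ, hψ] at hij; rw [hij]
        refine Peelable.step _ e (mono_along e (MForm.eval_mono φ)) (fun y => ?_) ?_ ?_
        · rintro ⟨h1, h0, -, -⟩
          have := MForm.eval_eq_of_not_mem_vars φ he (Fin.insertNth e false y) true
          rw [update_insertNth] at this
          rw [this, h0] at h1
          exact Bool.false_ne_true h1
        · rw [hsec false]
          exact peelable_eval (n + 1) _ (MForm.readOnce_substMap e false ψ hinj φ hro) (MForm.normal_substMap e false ψ φ)
        · rw [hsec true]
          exact peelable_eval (n + 1) _ (MForm.readOnce_substMap e true ψ hinj φ hro) (MForm.normal_substMap e true ψ φ)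
      · -- (b) every variable occurs: the formula is constant-free with at least two variables
        push Not at hfree
        have hnc : φ.NoConst := by
          rcases hno with rfl | rfl | h
          · exact absurd (hfree 0) (by simp [MForm.vars])
          · exact absurd (hfree 0) (by simp [MForm.vars])
          · exact h
        have hnv : ∀ i, φ ≠ MForm.var i := by
          rintro i rfl
          have h0 : (0 : Fin (n + 2)) ∈ (MForm.var i).vars := hfree 0
          have h1 : (1 : Fin (n + 2)) ∈ (MForm.var i).vars := hfree 1
          simp only [MForm.vars, Finset.mem_singleton] at h0 h1
          have h01 : (0 : Fin (n + 2)) = 1 := h0.trans h1.symm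
          exact absurd (congrArg Fin.val h01) (by simp)
        obtain ⟨e, f, hp⟩ := MForm.exists_pair_of_noConst φ hnc hnv
        obtain ⟨c, hc⟩ := MForm.pivotal_forces_sibling φ hro hp
        have hfe : f ≠ e := (MForm.ne_of_hasPair φ hro hp).symm
        obtain ⟨f', rfl⟩ := Fin.exists_succAbove_eq hfe
        let ψ : Fin (n + 2) → Fin (n + 1) := Function.invFun e.succAbove
        have hψ : ∀ j, ψ (e.succAbove j) = j := Function.leftInverse_invFun Fin.succAbove_right_injective
        have hsec : ∀ t : Bool, (fun y => φ.eval (Fin.insertNth e t y)) = (MForm.substMap e t ψ φ).eval := by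
          intro t; funext y
          rw [MForm.eval_substMap, insertNth_eq_ite e ψ hψ]
        have hinj : ∀ i j, i ≠ e → j ≠ e → ψ i = ψ j → i = j := by
          intro i j hi hj hij
          obtain ⟨i', rfl⟩ := Fin.exists_succAbove_eq hi
          obtain ⟨j', rfl⟩ := Fin.exists_succAbove_eq hj
          rw [hψ, hψ] at hij; rw [hij]
        -- pivotality at a lifted point forces the value of the sibling coordinate
        have hpiv : ∀ y : Fin (n + 1) → Bool,
            φ.eval (Fin.insertNth e true y) = true → φ.eval (Fin.insertNth e false y) = false → y f' = c := by
          intro y h1 h0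
          have := hc (Fin.insertNth e false y) (by rw [update_insertNth]; exact h1) (by rw [update_insertNth]; exact h0)
          simpa [Fin.insertNth_apply_succAbove] using this
        refine Peelable.step _ e (mono_along e (MForm.eval_mono φ)) (fun y => ?_) ?_ ?_
        · rintro ⟨h1, h0, h1', h0'⟩
          have hy : y f' = c := hpiv y h1 h0
          have hy' : (!y f') = c := hpiv (fun j => !y j) h1' h0'
          rw [hy] at hy'
          cases c <;> simp at hy'
        · rw [hsec false]
          exact peelable_eval (n + 1) _ (MForm.readOnce_substMap e false ψ hinj φ hro) (MForm.normal_substMap e false ψ φ)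
        · rw [hsec true]
          exact peelable_eval (n + 1) _ (MForm.readOnce_substMap e true ψ hinj φ hro) (MForm.normal_substMap e true ψ φ)

/-- **Read-once third events are peelable.** [this work] -/
theorem peelable_of_readOnce (φ : MForm n) (h : φ.ReadOnce) : Peelable n φ.eval := by
  rw [← MForm.eval_norm]
  exact peelable_eval n φ.norm (MForm.readOnce_norm φ h) (MForm.normal_norm φ)

/-- **THEOREM (comb form of the `F`-inequality for read-once third events).**  For every read-once monotone formula `φ` in
the variables `Fin n` and all monotone events `A, B` on the cube `Fin n → Bool`, the top tensor-Bernstein coefficient of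
`F(A,B;G)`, `G = eval φ`, is nonnegative:
`#{x ∈ ABG} − #{x ∈ AG : x̄ ∈ BG} − #{x ∈ G : x̄ ∈ AB ∖ G} ≥ 0`.
Restrictions of read-once events to faces are read-once, so every tensor-Bernstein coefficient of `F(A,B;G)` is `≥ 0` and
`F(A,B;G) ≥ 0` for every product measure (memo Theorem 3; the Bernstein bookkeeping is not formalised here). [this work] -/
theorem comb_sum_nonneg_of_readOnce (φ : MForm n) (h : φ.ReadOnce) (A B : (Fin n → Bool) → Bool)
    (hA : Monotone A) (hB : Monotone B) :
    0 ≤ ∑ x : Fin n → Bool, (((Bool.toNat (A x && B x && φ.eval x) : ℕ) : ℤ)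
          - ((Bool.toNat (A x && φ.eval x && B (fun i => !x i) && φ.eval (fun i => !x i)) : ℕ) : ℤ)
          - ((Bool.toNat (φ.eval x && A (fun i => !x i) && B (fun i => !x i) && !(φ.eval (fun i => !x i))) : ℕ) : ℤ)) :=
  comb_sum_nonneg_of_peelable (peelable_of_readOnce φ h) A B hA hB



end SahiFComb

end Summit.CriticalPhenomena.PercolationContinuityZ3.Theorems
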